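import Literature.Geometry.Lorentzian.CauchyProblemMGHDExistence
import Literature.Geometry.Lorentzian.LeviCivitaProofs
import Literature.Geometry.Lorentzian.FinalState
import HarnessLib

/-!
# MGHD existence (Choquet-Bruhat–Geroch 1969, Thm. 3) — proved corollaries of the named fact
# `choquetBruhat_geroch_exists_mghd_cauchy` in the shapes its consumers ask for

Cite item `wi-20397` (route FinalStateConjecture/ConcentrationCannotWait, item
`stmt-FinalStateConjecture-9981`, `MaximalDevelopmentExists`) asked for the corrected MGHD existence
fact over the repaired structure `VacuumCauchyDevelopment`. That fact is ALREADY in the tree: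
`Literature.Geometry.Lorentzian.choquetBruhat_geroch_exists_mghd_cauchy`
(`CauchyProblemMGHDExistence.lean`; the manifold `X` bound inside the proposition). Nothing is
re-declared here. This file only threads the fact, by one-line proofs, into the three shapes in
which it is consumed, so that no consumer has to redo the instance bookkeeping:

* `choquetBruhat_geroch_exists_mghd_cauchy.exists_isMaximal` — the `Σ`-context shape recorded in
  the module docstring of `CauchyProblem.lean` (§ Verdict clean-up): `X` a section variable,
  `[D.metric.HasLeviCivita]` an instance argument, `D.IsVacuumConstraintSolution → ∃ 𝒟, 𝒟.IsMaximal`;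
  and `….nonempty_vacuumCauchyDevelopment`, the corrected LOCAL EXISTENCE statement recorded there
  (Choquet-Bruhat–Geroch 1969, Thm. 1, p. 331: "Every initial data set has a development"), which as
  a statement is a corollary of MGHD existence (in print the implication runs the other way:
  Thm. 1 is an input of Thm. 3).
* `choquetBruhat_geroch_exists_mghd_cauchy.exists_isMaximal_of_mem_admissibleVacuumData` — for a
  datum of Christodoulou's admissible class `admissibleVacuumData X` (`FinalState.lean`: vacuum
  constraints + completeness + one strongly asymptotically flat end), with NO Levi-Civita instance
  argument: the standing hypothesis `[D.metric.HasLeviCivita]` is supplied outright by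
  `PseudoRiemannianMetric.hasLeviCivita` (`LeviCivitaProofs`, O'Neill 1983, Ch. 3, Thm. 3.11), and the
  constraint hypothesis by `isVacuumConstraintSolution_of_mem_admissibleVacuumData`.
* `choquetBruhat_geroch_exists_mghd_cauchy.forall_mem_admissibleVacuumData` — the same with `X`
  bound inside, i.e. VERBATIM the statement of the route items `MaximalDevelopmentExists`
  (ConcentrationCannotWait, stmt-FinalStateConjecture-9981) / `AdmissibleMGHDExists` (ProbeNullTrace,
  stmt-FinalStateConjecture-9937) and of the identically shaped `MGHDExistence` / `MGHDExists` /
  `MaximalDevelopmentExists` items of the other routes of summit `FinalStateConjecture` (the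
  anti-vacuity conjunct; `∀ D ∈ S, P` and `∀ D, D ∈ S → P`, `𝓡 3` and `𝓘(ℝ, E3)`, `∞` and
  `((⊤ : ℕ∞) : ℕ∞ω)` are the same terms): a prover closes any of them by
  `exact h.forall_mem_admissibleVacuumData`.

**Sources (read).** Choquet-Bruhat–Geroch, Commun. Math. Phys. 14 (1969) 329–335: p. 331
(initial data set; development = solution of Einstein's equations with `Σ` embedded onto a spacelike
Cauchy surface inducing `(h, K)`, footnote 5: "every timelike curve in M, without endpoint, must
intersect S once and only once"; Thm. 1 "Every initial data set has a development"; Definition of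
extension; Thm. 2), p. 332, **Theorem 3: "Let S be an initial data set. Then there exists a
development M of S which is an extension of every other development of S. This development is
unique (up to isometry)."** Sbierski, Ann. Henri Poincaré 17 (2016) 301–329 = arXiv:1309.7591v3,
§2: Def. of GHD / extension / CGHD, Thm. "Existence of MGHD": "Given initial data there exists a GHD
`M̃` that is an extension of any other GHD of the same initial data. The GHD `M̃` is unique up to
isometry and is called the maximal globally hyperbolic development (MGHD)" (Thm. 2.8 in the arXiv v3
numbering used by this cluster; proof without Zorn's lemma). Ringström 2009, Thm. 16.6 is cited by
the fact's docstring and not re-read here.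

## References

* [ChoquetBruhatGeroch1969CMP] Y. Choquet-Bruhat, R. Geroch, *Global aspects of the Cauchy problem
  in general relativity*, Comm. Math. Phys. 14 (1969), 329–335, Thm. 1 (p. 331), Thm. 3 (p. 332).
* [Sbierski2015] J. Sbierski, *On the existence of a maximal Cauchy development for the Einstein
  equations: a dezornification*, Ann. Henri Poincaré 17 (2016), 301–329 (arXiv:1309.7591v3, Thm. 2.8).
* [Christodoulou1999] D. Christodoulou, *On the global initial value problem and the issue of
  singularities*, CQG 16 (1999), A23–A35, p. A24 (the admissible class).
* [ONeill1983] B. O'Neill, *Semi-Riemannian Geometry*, 1983, Ch. 3, Thm. 3.11 (Levi-Civita).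
-/

noncomputable section

open scoped Manifold ContDiff

namespace Literature.Geometry.Lorentzian

namespace choquetBruhat_geroch_exists_mghd_cauchy

section SigmaContext

variable {X : Type} [TopologicalSpace X] [ChartedSpace E3 X] [IsManifold (𝓡 3) ∞ X]
  [T2Space X] [SecondCountableTopology X] [ConnectedSpace X]

/-- **MGHD existence in the `Σ`-context of `CauchyProblem.lean`** (the corrected statement recorded
in its module docstring, `X` a section variable): under `choquetBruhat_geroch_exists_mghd_cauchy`,
every smooth vacuum initial data set `D` on the connected, Hausdorff, second countable `3`-manifold
`X` solving the vacuum constraints has a maximal vacuum Cauchy development. Choquet-Bruhat–Geroch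
1969, Thm. 3 (p. 332): "there exists a development M of S which is an extension of every other
development of S". [cite: ChoquetBruhatGeroch1969CMP, Thm. 3 (p. 332)] -/
theorem exists_isMaximal (h : choquetBruhat_geroch_exists_mghd_cauchy) (D : InitialDataSet (𝓡 3) X)
    [D.metric.HasLeviCivita] (hD : D.IsVacuumConstraintSolution) :
    ∃ 𝒟 : VacuumCauchyDevelopment D, 𝒟.IsMaximal :=
  h X D hD

/-- **Local existence over the repaired structure, from MGHD existence** (the corrected form of the
deprecated `choquetBruhat_local_existence`, recorded in the module docstring of `CauchyProblem.lean`):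
under `choquetBruhat_geroch_exists_mghd_cauchy`, every smooth solution of the vacuum constraints on
`X` has a vacuum Cauchy development. Choquet-Bruhat–Geroch 1969, Thm. 1 (p. 331): "Every initial
data set has a development" (Fourès-Bruhat 1952); as a statement a corollary of Thm. 3, although in
print Thm. 1 is an input of the proof of Thm. 3. [cite: ChoquetBruhatGeroch1969CMP, Thm. 1 (p. 331)] -/
theorem nonempty_vacuumCauchyDevelopment (h : choquetBruhat_geroch_exists_mghd_cauchy)
    (D : InitialDataSet (𝓡 3) X) [D.metric.HasLeviCivita] (hD : D.IsVacuumConstraintSolution) :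
    Nonempty (VacuumCauchyDevelopment D) :=
  let ⟨𝒟, _⟩ := h X D hD
  ⟨𝒟⟩

/-- **MGHD existence for Christodoulou-admissible data**, with no instance argument: under
`choquetBruhat_geroch_exists_mghd_cauchy`, every datum of the admissible class
`admissibleVacuumData X` (Christodoulou, CQG 16 (1999), p. A24: complete, strongly asymptotically
flat solutions of the vacuum constraints with one end) has a maximal vacuum Cauchy development.
The standing Levi-Civita hypothesis of the fact is discharged by
`PseudoRiemannianMetric.hasLeviCivita` (O'Neill 1983, Ch. 3, Thm. 3.11) and the constraint
hypothesis by `isVacuumConstraintSolution_of_mem_admissibleVacuumData`. Choquet-Bruhat–Geroch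
1969, Thm. 3 (p. 332), restricted to the admissible class. [cite: ChoquetBruhatGeroch1969CMP, Thm. 3 (p. 332)] -/
theorem exists_isMaximal_of_mem_admissibleVacuumData (h : choquetBruhat_geroch_exists_mghd_cauchy)
    {D : InitialDataSet (𝓡 3) X} (hD : D ∈ admissibleVacuumData X) :
    ∃ 𝒟 : VacuumCauchyDevelopment D, 𝒟.IsMaximal :=
  haveI := D.metric.hasLeviCivita
  h X D (isVacuumConstraintSolution_of_mem_admissibleVacuumData hD)

end SigmaContext

/-- **MGHD existence for admissible data, `X` bound inside** — verbatim the statement of the route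
items `MaximalDevelopmentExists` (FinalStateConjecture/ConcentrationCannotWait,
stmt-FinalStateConjecture-9981) and `AdmissibleMGHDExists` (FinalStateConjecture/ProbeNullTrace,
stmt-FinalStateConjecture-9937), the anti-vacuity conjunct shared by the routes of summit
`FinalStateConjecture`: for every connected, Hausdorff, second countable smooth `3`-manifold `X` and
every `D ∈ admissibleVacuumData X` there is a maximal vacuum Cauchy development of `D`. From
`choquetBruhat_geroch_exists_mghd_cauchy` (Choquet-Bruhat–Geroch 1969, Thm. 3, p. 332) by
`exists_isMaximal_of_mem_admissibleVacuumData`; a prover closes such an item by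
`exact h.forall_mem_admissibleVacuumData`. [cite: ChoquetBruhatGeroch1969CMP, Thm. 3 (p. 332)] -/
theorem forall_mem_admissibleVacuumData (h : choquetBruhat_geroch_exists_mghd_cauchy) :
    ∀ (X : Type) [TopologicalSpace X] [ChartedSpace E3 X] [IsManifold (𝓡 3) ∞ X] [T2Space X]
      [SecondCountableTopology X] [ConnectedSpace X], ∀ D ∈ admissibleVacuumData X,
      ∃ 𝒟 : VacuumCauchyDevelopment D, 𝒟.IsMaximal :=
  fun _ _ _ _ _ _ _ _ hD ↦ h.exists_isMaximal_of_mem_admissibleVacuumData hD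

end choquetBruhat_geroch_exists_mghd_cauchy

end Literature.Geometry.Lorentzian

end
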